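import Mathlib.FieldTheory.IntermediateField.Adjoin.Algebra
import Mathlib.FieldTheory.PrimitiveElement
import Mathlib.FieldTheory.Perfect
import Mathlib.RingTheory.DedekindDomain.IntegralClosure
import Mathlib.RingTheory.IntegralClosure.IntegrallyClosed
import Mathlib.RingTheory.Adjoin.Polynomial.Basic
import Mathlib.RingTheory.FiniteType
import Mathlib.RingTheory.MvPolynomial.Localization
import Mathlib.RingTheory.MvPolynomial.Tower
import Mathlib.RingTheory.AlgebraicIndependent.TranscendenceBasis
import Mathlib.RingTheory.AlgebraicIndependent.Adjoin
import Mathlib.RingTheory.Polynomial.UniqueFactorization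
import Literature.AlgebraicGeometry.Motives.CurveThroughTwoPointsFibre
import Literature.AlgebraicGeometry.Motives.CurveThroughTwoPointsPencil
import Literature.AlgebraicGeometry.Resolution.AffineDomainEquidim
import Literature.RingTheory.KrullDimension.AffineDimension
import Literature.AlgebraicGeometry.Motives.CurveThroughTwoPointsNoetherSpecialization
import Literature.AlgebraicGeometry.Motives.CurveThroughTwoPointsHypersurfaceModel
import Literature.AlgebraicGeometry.Resolution.NormalizationOfVarietiesProofs
import Literature.FieldTheory.Regular.FiniteAlgebraicClosure
import Literature.AlgebraicGeometry.Motives.CurveThroughTwoPointsLemmas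
import HarnessLib

/-!
# Mumford's two-point lemma: the algebraic heart (any two closed points of an affine variety lie on an irreducible curve)

Topic `Literature/AlgebraicGeometry/Motives`. This file PROVES the affine algebraic form of the
lemma of Mumford, *Abelian Varieties* (1970), §6 ("Any two points of an irreducible variety lie on
an irreducible curve"), which the named fact `mumford_smoothCurve_through_two_points`
(`Motives/CurveThroughTwoPoints`) was waiting for:

* `TwoPointPencil.exists_prime_le_inf_ringKrullDim_quotient_eq_one` — for an algebraically closed
  field `K` of characteristic `0`, a finitely generated `K`-domain `A` and maximal ideals `𝔪₁ ≠ 𝔪₂`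
  there is a prime `𝔭 ⊆ 𝔪₁ ∩ 𝔪₂` with `dim A/𝔭 = 1`.

Mumford's printed proof blows up the two points and cuts the blow-up by general hyperplane
sections, using Bertini's irreducibility theorem, which Mathlib does not have. The proof given
here is an ELEMENTARY REPLACEMENT by induction on `n = dim A` (the case `n = 1` being `𝔭 = 0`):

1. (`Motives/CurveThroughTwoPointsPencil`) choose `g, h ∈ 𝔪₁ ∩ 𝔪₂` with `h` outside the minimal
   primes of `(g)` and pass to the pencil `B = A[g/h] ⊆ Frac A`; the two points give retractions
   `σᵢ : B → K[t]` (`t = g/h`, transcendental over `K`) with `ker σᵢ ∩ A = 𝔪ᵢ`.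
2. (`exists_prime_le_of_two_sections`, this file) MAIN LEMMA: for a finitely generated
   `K`-subalgebra `B` of a finitely generated field `E = Frac B` of transcendence degree `≥ 2`,
   containing `t` transcendental over `K`, and retractions `σᵢ : B → K[t]`, there is a nonzero prime
   `𝔓 ⊆ B` lying, for each `i`, below a prime containing `ker σᵢ`. Construction: `L` = the
   algebraic closure of `K(t)` in `E` (finite over `K(t)`, `FieldTheory/Regular/FiniteAlgebraicClosure`),
   `R` = the integral closure of `K[t]` in `L` (a Dedekind domain), `B'` = the normalisation of `B`
   (noetherian, `Resolution/NormalizationOfVarietiesProofs`), a transcendence basis `x` of `E/L`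
   inside `B`, a primitive element giving a hypersurface model `B₀ = R[x, y] ≅ R[X]/(F)` with `F`
   absolutely irreducible over `L` (`Motives/CurveThroughTwoPointsHypersurfaceModel`), Noether
   specialisation of absolute irreducibility to almost all maximal ideals `𝔞 ⊆ R`
   (`Motives/CurveThroughTwoPointsNoetherSpecialization`, Kaltofen's effective Noether forms), and
   the fibre comparison `B' ⊆ B₀[1/c]` showing that the fibre of `Spec B' → Spec R` over a good
   `𝔞` is irreducible (`Motives/CurveThroughTwoPointsFibre`); the sections survive in `B'` by
   lying over in `B'/𝔯ᵢ''`, which is integral over `R` (`Motives/CurveThroughTwoPointsLemmas`).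
   The generic prime of that fibre, contracted to `B`, is `𝔓`.
3. Contract `𝔓` to `A`: a nonzero, non-maximal prime inside `𝔪₁ ∩ 𝔪₂`; recurse in `A/𝔓 ∩ A`.

The scheme-theoretic translation and `mumford_smoothCurve_through_two_points_holds` are in
`Motives/CurveThroughTwoPointsProofs`.

Everything is proved; no named facts.

## References

* D. Mumford, *Abelian Varieties*, TIFR Studies in Math. 5, OUP 1970, §6, Lemma. [MumfordAV1970]
* E. Kaltofen, J. Comput. System Sci. 50 (1995) 274–295, Thm. 7 (effective Noether forms). [Kaltofen1995]
* S. Lang, *Algebra*, GTM 211 (2002), VIII §4 (algebraic closure in a finitely generated extension).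
-/

noncomputable section

open Polynomial

namespace Literature.AlgebraicGeometry.Motives

namespace TwoPointPencil

universe u


section MainLemma

open scoped IntermediateField IntermediateField.algebraAdjoinAdjoin

open Literature.NumberTheory.DiophantineGeometry (IsAbsIrreducible)

set_option maxHeartbeats 800000 in
set_option synthInstance.maxHeartbeats 200000 in
/-- **Core of the main lemma.** Abstract form: `B ⊆ E = Frac B` a finitely generated
`K`-subalgebra of a finitely generated field, `L ⊆ E` a subfield relatively algebraically closed in
`E` with `E/L` transcendental, `R ⊆ L` a Dedekind, Jacobson, non-field subring with fraction field
`L` mapping into the normalisation of `B`, `P → R` integral with `P` a domain, `ι : P → B` and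
retractions `σᵢ : B → P` (`σᵢ ∘ ι = id`). Then some nonzero prime `𝔓 ⊆ B` lies below primes
containing the `ker σᵢ`: the contraction of the generic prime of an irreducible fibre of the
normalisation of `B` over a good maximal ideal of `R` (hypersurface model, Noether specialisation,
fibre comparison, lying over). [cite: MumfordAV1970, §6, Lemma (proof replaced by an elementary
pencil argument)] -/
theorem exists_prime_le_of_sections_core {K : Type u} [Field K] {E : Type u} [Field E]
    [Algebra K E] [Algebra.EssFiniteType K E] (B : Subalgebra K E) [Algebra.FiniteType K B]
    [IsFractionRing B E] {L : Type u} [Field L] [CharZero L] [Algebra L E] [Algebra K L]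
    [IsScalarTower K L E] (hrac : ∀ z : E, IsAlgebraic L z → z ∈ Set.range (algebraMap L E))
    (htrans : ¬ Algebra.IsAlgebraic L E) {R : Type u} [CommRing R] [IsDedekindDomain R]
    [IsJacobsonRing R] [Algebra R L] [IsFractionRing R L] [Algebra R E] [IsScalarTower R L E]
    [Algebra K R] [IsScalarTower K R E] (hRnf : ¬ IsField R)
    (hRB' : ∀ r : R, algebraMap R E r ∈ integralClosure B E) {P : Type u} [CommRing P]
    [IsDomain P] [Algebra P R] [Algebra.IsIntegral P R] (ι : P →+* B)
    (hιR : ∀ p, algebraMap R E (algebraMap P R p) = (ι p : E)) {I : Type*} (σ : I → (B →+* P))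
    (hσι : ∀ i p, σ i (ι p) = p) :
    ∃ 𝔓 : Ideal B, 𝔓.IsPrime ∧ 𝔓 ≠ ⊥ ∧
      ∀ i, ∃ 𝔔 : Ideal B, 𝔔.IsPrime ∧ RingHom.ker (σ i) ≤ 𝔔 ∧ 𝔓 ≤ 𝔔 := by
  classical
  haveI : CharZero E := charZero_of_injective_algebraMap (algebraMap L E).injective
  have hRinj : Function.Injective (algebraMap R E) := by
    rw [IsScalarTower.algebraMap_eq R L E]
    exact (algebraMap L E).injective.comp (IsFractionRing.injective R L)
  /- Step 1: the normalisation `B'` of `B` is noetherian. -/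
  let B' : Subalgebra B E := integralClosure B E
  haveI : IsNoetherianRing B := Algebra.FiniteType.isNoetherianRing K B
  haveI : Module.Finite B B' :=
    Literature.AlgebraicGeometry.Resolution.NoetherFiniteIntegralClosure_holds K B E E
  haveI : IsNoetherianRing B' := isNoetherianRing_iff.mpr (isNoetherian_of_tower B inferInstance)
  /- Step 2: a transcendence basis `x` of `E/L` inside `B`. -/
  obtain ⟨G, hG⟩ := Algebra.FiniteType.out (R := K) (A := B)
  let Gset : Set E := (fun b : B => (b : E)) '' (G : Set B)
  have hGB : Gset ⊆ B := by
    rintro _ ⟨b, -, rfl⟩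
    exact b.2
  have hBG : B = Algebra.adjoin K Gset := by
    apply le_antisymm
    · have h1 : (⊤ : Subalgebra K B).map B.val = Algebra.adjoin K Gset := by
        rw [← hG, AlgHom.map_adjoin]
        rfl
      intro z hz
      rw [← h1]
      exact Subalgebra.mem_map.mpr ⟨⟨z, hz⟩, Algebra.mem_top, rfl⟩
    · exact Algebra.adjoin_le hGB
  let SG : Subalgebra L E := Algebra.adjoin L Gset
  haveI : IsFractionRing SG E :=
    isFractionRing_of_subalgebra (A := B) SG fun b => by
      change (b : E) ∈ SG
      have hb : (b : E) ∈ Algebra.adjoin K Gset := hBG ▸ b.2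
      exact Algebra.adjoin_le (S := SG.restrictScalars K) Algebra.subset_adjoin hb
  haveI : Algebra.IsAlgebraic SG E := IsLocalization.isAlgebraic E (nonZeroDivisors SG)
  obtain ⟨u, huG, hu⟩ := exists_isTranscendenceBasis_subset (R := L) Gset
  have hufin : u.Finite := ((G.finite_toSet).image _).subset huG
  obtain ⟨m, ⟨eu⟩⟩ : ∃ m : ℕ, Nonempty (u ≃ Fin m) :=
    ⟨_, ⟨@Fintype.equivFin u hufin.fintype⟩⟩
  let x : Fin m → E := (Subtype.val : u → E) ∘ eu.symm
  have hx : IsTranscendenceBasis L x := (isTranscendenceBasis_equiv eu.symm).mpr hu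
  have hxB : ∀ i, x i ∈ B := fun i => hGB (huG (eu.symm i).2)
  have hm1 : 1 ≤ m := by
    by_contra h0
    have hm0 : m = 0 := by omega
    haveI : IsEmpty (Fin m) := by rw [hm0]; infer_instance
    exact htrans (hx.isEmpty_iff_isAlgebraic.mp inferInstance)
  /- Step 3: a primitive element `α` of `E / L(x)`, algebraic over `R[x]`, and an `R[x]`-integral
  multiple `y` of it. -/
  let Lx : IntermediateField L E := IntermediateField.adjoin L (Set.range x)
  haveI : Algebra.IsAlgebraic Lx E := hx.isAlgebraic_field
  haveI iKLxE : IsScalarTower K Lx E := IsScalarTower.of_algebraMap_eq fun _ => rfl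
  haveI : Algebra.EssFiniteType Lx E := Algebra.EssFiniteType.of_comp K Lx E
  haveI : FiniteDimensional Lx E := Algebra.finite_of_essFiniteType_of_isAlgebraic
  haveI : CharZero Lx := charZero_of_injective_algebraMap (algebraMap L Lx).injective
  haveI : PerfectField Lx := PerfectField.ofCharZero
  haveI : Algebra.IsSeparable Lx E := Algebra.IsAlgebraic.isSeparable_of_perfectField
  obtain ⟨α, hα⟩ := Field.exists_primitive_element Lx E
  let Rx := MvPolynomial (Fin m) R
  let Lxp := MvPolynomial (Fin m) L
  letI algRxLxp : Algebra Rx Lxp := MvPolynomial.algebraMvPolynomial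
  letI algRx : Algebra Rx E := (MvPolynomial.aeval (R := R) (S₁ := E) x).toRingHom.toAlgebra
  letI algLxp : Algebra Lxp E := (MvPolynomial.aeval (R := L) (S₁ := E) x).toRingHom.toAlgebra
  have halgRx : ∀ p : Rx, algebraMap Rx E p = MvPolynomial.aeval x p := fun _ => rfl
  have halgLxp : ∀ p : Lxp, algebraMap Lxp E p = MvPolynomial.aeval x p := fun _ => rfl
  have hRL : ∀ p : Rx, algebraMap Rx Lxp p = MvPolynomial.map (algebraMap R L) p := fun _ => rfl
  haveI : IsScalarTower Rx Lxp E := IsScalarTower.of_algebraMap_eq fun p => by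
    rw [halgRx, halgLxp, hRL, MvPolynomial.aeval_map_algebraMap]
  haveI : Algebra.IsAlgebraic Rx Lxp :=
    IsLocalization.isAlgebraic Lxp ((nonZeroDivisors R).map (MvPolynomial.C : R →+* Rx))
  haveI : Algebra.IsAlgebraic (Algebra.adjoin L (Set.range x)) E := hx.isAlgebraic
  have hαL : IsAlgebraic Lxp α := by
    let Sx : Subalgebra L E := Algebra.adjoin L (Set.range x)
    let ex : Lxp ≃ₐ[L] Sx := hx.1.aevalEquiv
    have hex : ∀ p : Lxp, ((ex p : Sx) : E) = MvPolynomial.aeval x p := fun p =>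
      hx.1.algebraMap_aevalEquiv p
    have h1 : IsAlgebraic Sx α := Algebra.IsAlgebraic.isAlgebraic α
    have hcomp : (algebraMap Sx E).comp ex.toRingEquiv.toRingHom =
        (RingHom.id E).comp (algebraMap Lxp E) := by
      refine RingHom.ext fun p => ?_
      rw [RingHom.comp_apply, RingHom.comp_apply, RingHom.id_apply, halgLxp, ← hex]
      rfl
    exact IsAlgebraic.of_ringHom_of_comp_eq ex.toRingEquiv.toRingHom (RingHom.id E) h1
      ex.surjective Function.injective_id hcomp
  have hαR : IsAlgebraic Rx α := hαL.restrictScalars Rx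
  obtain ⟨sR, hsR0, hint⟩ := hαR.exists_integral_multiple
  obtain ⟨q, hqm, hqy⟩ := hint
  set y : E := sR • α with hy
  have hsR : algebraMap Rx E sR ≠ 0 := by
    rw [IsScalarTower.algebraMap_apply Rx Lxp E, halgLxp]
    intro h0
    rw [← map_zero (MvPolynomial.aeval (R := L) x)] at h0
    have := algebraicIndependent_iff_injective_aeval.mp hx.1 h0
    exact hsR0 (MvPolynomial.map_injective _ (IsFractionRing.injective R L)
      (by rw [map_zero, ← hRL]; exact this))
  /- Step 4: the hypersurface model `B₀ = R[x, y] ≅ R[X]/(F)` and Noether specialisation. -/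
  obtain ⟨F, d, hd, hFm, hFd, hkerR, hkerL, hirr⟩ :=
    exists_hypersurfaceModel (R := R) (L := L) (E := E) hrac x hx.1 y q hqm hqy
  have hD : 1 ≤ (MvPolynomial.map (algebraMap R L) F).totalDegree := by
    rw [Nat.one_le_iff_ne_zero]
    intro h0
    rw [MvPolynomial.totalDegree_eq_zero_iff_eq_C] at h0
    have hirr' := irreducible_of_isAbsIrreducible hirr
    rw [h0] at hirr'
    rcases eq_or_ne ((MvPolynomial.map (algebraMap R L) F).coeff 0) 0 with h | h
    · rw [h, MvPolynomial.C_0] at hirr'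
      exact not_irreducible_zero hirr'
    · exact hirr'.not_isUnit ((isUnit_iff_ne_zero.mpr h).map MvPolynomial.C)
  obtain ⟨δ, hδ0, hδ⟩ := exists_ne_zero_forall_isAbsIrreducible_map (R := R) (K := L) (N := m + 1)
    (d := (MvPolynomial.map (algebraMap R L) F).totalDegree) (by omega) hD F rfl hirr
  let v : Fin (m + 1) → E := Fin.cons y x
  have hv0 : v 0 = y := rfl
  have hvs : ∀ j : Fin m, v j.succ = x j := fun j => by simp [v]
  let B₀ : Subalgebra R E := (MvPolynomial.aeval v : MvPolynomial (Fin (m + 1)) R →ₐ[R] E).range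
  -- evaluation at `v` lands in any subring containing `R`, the `x i` and `y`
  have haevalmem : ∀ (T : Subring E), (∀ r : R, algebraMap R E r ∈ T) → (∀ i, x i ∈ T) → y ∈ T →
      ∀ p : MvPolynomial (Fin (m + 1)) R, MvPolynomial.aeval v p ∈ T := by
    intro T hTR hTx hTy p
    induction p using MvPolynomial.induction_on with
    | C a => rw [MvPolynomial.aeval_C]; exact hTR a
    | add p q hp hq => rw [map_add]; exact T.add_mem hp hq
    | mul_X p i hp =>
      rw [map_mul, MvPolynomial.aeval_X]
      refine T.mul_mem hp ?_
      refine Fin.cases ?_ (fun j => ?_) i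
      · rw [hv0]; exact hTy
      · rw [hvs]; exact hTx j
  -- in particular evaluation at `x`
  have haevalmem' : ∀ (T : Subring E), (∀ r : R, algebraMap R E r ∈ T) → (∀ i, x i ∈ T) →
      ∀ p : Rx, algebraMap Rx E p ∈ T := by
    intro T hTR hTx p
    rw [halgRx]
    induction p using MvPolynomial.induction_on with
    | C a => rw [MvPolynomial.aeval_C]; exact hTR a
    | add p q hp hq => rw [map_add]; exact T.add_mem hp hq
    | mul_X p i hp => rw [map_mul, MvPolynomial.aeval_X]; exact T.mul_mem hp (hTx i)
  have hxB' : ∀ i, x i ∈ B' := fun i => isIntegral_algebraMap (R := B) (x := (⟨x i, hxB i⟩ : B))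
  have hRxB' : ∀ p : Rx, algebraMap Rx E p ∈ B' := haevalmem' B'.toSubring hRB' hxB'
  have hyB' : y ∈ B' := by
    have h1 : IsIntegral B' y := by
      let ρ : Rx →+* B' := (algebraMap Rx E).codRestrict B' hRxB'
      refine ⟨q.map ρ, hqm.map ρ, ?_⟩
      rw [Polynomial.eval₂_map]
      exact hqy
    show IsIntegral B y
    exact isIntegral_trans y h1
  have hB₀B' : ∀ z ∈ B₀, z ∈ B' := by
    rintro _ ⟨p, rfl⟩
    exact haevalmem B'.toSubring (fun r => hRB' r) hxB' hyB' p
  have hB₀R : ∀ r : R, algebraMap R E r ∈ B₀ := fun r => B₀.algebraMap_mem r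
  have hB₀x : ∀ i, x i ∈ B₀ := fun i => ⟨MvPolynomial.X i.succ, by
    change MvPolynomial.aeval v (MvPolynomial.X i.succ) = x i
    rw [MvPolynomial.aeval_X, hvs]⟩
  have hB₀y : y ∈ B₀ := ⟨MvPolynomial.X 0, by
    change MvPolynomial.aeval v (MvPolynomial.X 0) = y
    rw [MvPolynomial.aeval_X, hv0]⟩
  /- Step 5: a common denominator `c ∈ B₀`: `B' ⊆ B₀[1/c]`. -/
  -- the subfield generated by `R`, `x` and `y` is all of `E`
  have hclosure : ∀ z : E,
      z ∈ Subfield.closure (Set.range (algebraMap R E) ∪ (Set.range x ∪ {y})) := by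
    set T := Subfield.closure (Set.range (algebraMap R E) ∪ (Set.range x ∪ {y})) with hT
    have hTR : ∀ r : R, algebraMap R E r ∈ T := fun r =>
      Subfield.subset_closure (Or.inl (Set.mem_range_self r))
    have hTx : ∀ i, x i ∈ T := fun i =>
      Subfield.subset_closure (Or.inr (Or.inl (Set.mem_range_self i)))
    have hTy : y ∈ T := Subfield.subset_closure (Or.inr (Or.inr rfl))
    have hTL : ∀ l : L, algebraMap L E l ∈ T := by
      intro l
      obtain ⟨a, b, -, rfl⟩ := IsFractionRing.div_surjective (A := R) l
      rw [map_div₀, ← IsScalarTower.algebraMap_apply, ← IsScalarTower.algebraMap_apply]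
      exact T.div_mem (hTR a) (hTR b)
    have hTLx : ∀ w : Lx, (w : E) ∈ T := by
      intro w
      have hw : (w : E) ∈ Lx.toSubfield := w.2
      rw [IntermediateField.adjoin_toSubfield] at hw
      refine Subfield.closure_le.mpr ?_ hw
      rintro _ (⟨l, rfl⟩ | ⟨i, rfl⟩)
      · exact hTL l
      · exact hTx i
    have hTα : α ∈ T := by
      have hyα : y = algebraMap Rx E sR * α := Algebra.smul_def sR α
      have hsT : algebraMap Rx E sR ∈ T := haevalmem' T.toSubring hTR hTx sR
      have : α = (algebraMap Rx E sR)⁻¹ * y := by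
        rw [hyα, ← mul_assoc, inv_mul_cancel₀ hsR, one_mul]
      rw [this]
      exact T.mul_mem (T.inv_mem hsT) hTy
    intro z
    have hz : z ∈ (⊤ : IntermediateField Lx E) := IntermediateField.mem_top
    rw [← hα] at hz
    have hz' : z ∈ (Lx⟮α⟯).toSubfield := hz
    rw [IntermediateField.adjoin_toSubfield] at hz'
    refine Subfield.closure_le.mpr ?_ hz'
    rintro _ (⟨w, rfl⟩ | h)
    · exact hTLx w
    · rw [Set.mem_singleton_iff.mp h]
      exact hTα
  have hden : ∀ z : E, ∃ d ∈ B₀.toSubring, d ≠ 0 ∧ d * z ∈ B₀.toSubring := fun z =>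
    exists_denominator_of_mem_closure B₀.toSubring (G := Set.range (algebraMap R E) ∪
      (Set.range x ∪ {y})) (by
        rintro _ (⟨r, rfl⟩ | ⟨i, rfl⟩ | h)
        · exact hB₀R r
        · exact hB₀x i
        · rw [Set.mem_singleton_iff.mp h]; exact hB₀y) (hclosure z)
  -- generators of `B` over `K` and of `B'` over `B`
  obtain ⟨W, hW⟩ := Module.Finite.fg_top (R := B) (M := B')
  obtain ⟨c, hcB₀, hc0, hcmul⟩ := exists_common_denominator B₀.toSubring
    (G.image (fun b : B => (b : E)) ∪ W.image (fun w : B' => (w : E))) (fun g _ => hden g)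
  -- the elements `z` with `c^N z ∈ B₀` for some `N` form a `K`-subalgebra containing `B` and `B'`
  let SP : Subalgebra K E :=
    { carrier := {z | ∃ N : ℕ, c ^ N * z ∈ B₀}
      mul_mem' := by
        rintro a b ⟨N₁, h₁⟩ ⟨N₂, h₂⟩
        refine ⟨N₁ + N₂, ?_⟩
        have : c ^ (N₁ + N₂) * (a * b) = (c ^ N₁ * a) * (c ^ N₂ * b) := by ring
        rw [this]
        exact B₀.mul_mem h₁ h₂
      one_mem' := ⟨0, by rw [pow_zero, one_mul]; exact B₀.one_mem⟩
      add_mem' := by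
        rintro a b ⟨N₁, h₁⟩ ⟨N₂, h₂⟩
        refine ⟨N₁ + N₂, ?_⟩
        have : c ^ (N₁ + N₂) * (a + b) = c ^ N₂ * (c ^ N₁ * a) + c ^ N₁ * (c ^ N₂ * b) := by ring
        rw [this]
        exact B₀.add_mem (B₀.mul_mem (B₀.pow_mem hcB₀ _) h₁) (B₀.mul_mem (B₀.pow_mem hcB₀ _) h₂)
      zero_mem' := ⟨0, by rw [mul_zero]; exact B₀.zero_mem⟩
      algebraMap_mem' := fun k => ⟨0, by
        rw [pow_zero, one_mul, IsScalarTower.algebraMap_apply K R E]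
        exact hB₀R _⟩ }
  have hSP : ∀ z : E, z ∈ SP ↔ ∃ N : ℕ, c ^ N * z ∈ B₀ := fun z => Iff.rfl
  have hBSP : B ≤ SP := by
    rw [hBG]
    refine Algebra.adjoin_le ?_
    rintro _ ⟨b, hb, rfl⟩
    refine ⟨1, ?_⟩
    rw [pow_one]
    exact hcmul _ (Finset.mem_union_left _ (Finset.mem_image_of_mem _ hb))
  have hB'SP : ∀ z : B', ∃ N : ℕ, c ^ N * (z : E) ∈ B₀ := by
    intro z
    have hz : z ∈ Submodule.span B (W : Set B') := by rw [hW]; exact Submodule.mem_top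
    induction hz using Submodule.span_induction with
    | mem w hw =>
      refine ⟨1, ?_⟩
      rw [pow_one]
      exact hcmul _ (Finset.mem_union_right _ (Finset.mem_image_of_mem _ hw))
    | zero => exact ⟨0, by rw [ZeroMemClass.coe_zero, mul_zero]; exact B₀.zero_mem⟩
    | add a b _ _ ha hb =>
      exact (hSP _).mp (SP.add_mem ((hSP _).mpr ha) ((hSP _).mpr hb))
    | smul b w _ hw =>
      have : ((b • w : B') : E) = (b : E) * (w : E) := rfl
      rw [this]
      exact (hSP _).mp (SP.mul_mem (hBSP b.2) ((hSP _).mpr hw))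
  /- Step 6: the specialisation `𝔞` avoiding finitely many bad maximal ideals. -/
  -- a reduced representative of `c` with a coefficient `γ` witnessing `c ∉ 𝔞B₀`
  obtain ⟨cp, hcp⟩ : ∃ p : MvPolynomial (Fin (m + 1)) R, MvPolynomial.aeval v p = c := by
    exact hcB₀
  have hcpF : cp ∉ Ideal.span {F} := by
    intro h
    rw [← hkerR, RingHom.mem_ker] at h
    exact hc0 (by rw [← hcp]; exact h)
  obtain ⟨rp, γ, hγ0, hcr, hγ⟩ := exists_remainder_witness F hFm cp hcpF
  have hrp : MvPolynomial.aeval v rp = c := by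
    have h : cp - rp ∈ RingHom.ker (MvPolynomial.aeval v : MvPolynomial (Fin (m + 1)) R →ₐ[R] E) := by
      rw [hkerR]; exact hcr
    rw [RingHom.mem_ker, map_sub, sub_eq_zero] at h
    rw [← h, hcp]
  -- the `R`-algebra `B'` and the inclusion `φ : B₀ → B'`
  let Bt : Type u := B'
  let ψ : R →+* Bt := (algebraMap R E).codRestrict B' hRB'
  letI algRBt : Algebra R Bt := ψ.toAlgebra
  have hψ : ∀ r : R, algebraMap R Bt r = ψ r := fun _ => rfl
  have hψval : ∀ r : R, ((ψ r : Bt) : E) = algebraMap R E r := fun _ => rfl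
  let φ : B₀ →ₐ[R] Bt :=
    { toFun := fun b => ⟨b.1, hB₀B' b.1 b.2⟩
      map_one' := rfl
      map_mul' := fun _ _ => rfl
      map_zero' := rfl
      map_add' := fun _ _ => rfl
      commutes' := fun _ => rfl }
  have hφval : ∀ b : B₀, ((φ b : Bt) : E) = (b : E) := fun _ => rfl
  have hφ : Function.Injective φ := fun a b h => Subtype.ext (congrArg (fun z : Bt => (z : E)) h)
  let c' : B₀ := ⟨c, hcB₀⟩
  have hc' : ∀ z : Bt, ∃ N : ℕ, ∃ w : B₀, φ c' ^ N * z = φ w := by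
    intro z
    obtain ⟨N, hN⟩ := hB'SP z
    have h1 : ((φ c' ^ N * z : Bt) : E) = c ^ N * (z : E) := by
      rw [MulMemClass.coe_mul, SubmonoidClass.coe_pow, hφval]
    exact ⟨N, ⟨c ^ N * (z : E), hN⟩, Subtype.ext h1⟩
  -- avoiding the contractions of the minimal primes of `cB'`
  obtain ⟨ε₃, hε₃0, hε₃⟩ := exists_avoid_minimalPrimes ψ (Ideal.span {φ c'})
  -- the good maximal ideal
  obtain ⟨𝔞, h𝔞max, h𝔞0, hε𝔞⟩ :=
    exists_isMaximal_notMem_of_ne_zero hRnf (mul_ne_zero (mul_ne_zero hδ0 hγ0) hε₃0)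
  haveI := h𝔞max
  have hδ𝔞 : δ ∉ 𝔞 := fun h => hε𝔞 (Ideal.mul_mem_right _ _ (Ideal.mul_mem_right _ _ h))
  have hγ𝔞 : γ ∉ 𝔞 := fun h => hε𝔞 (Ideal.mul_mem_right _ _ (Ideal.mul_mem_left _ _ h))
  have hε₃𝔞 : ε₃ ∉ 𝔞 := fun h => hε𝔞 (Ideal.mul_mem_left _ _ h)
  -- the fibre of the model over `𝔞` is integral
  have hprimeF : (Ideal.span {MvPolynomial.map (Ideal.Quotient.mk 𝔞) F}).IsPrime := by
    letI : Field (R ⧸ 𝔞) := Ideal.Quotient.field 𝔞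
    have hπδ : Ideal.Quotient.mk 𝔞 δ ≠ 0 := by
      rwa [Ne, Ideal.Quotient.eq_zero_iff_mem]
    have habs := (hδ (R ⧸ 𝔞) (Ideal.Quotient.mk 𝔞) hπδ).2
    have hirr𝔞 : Irreducible (MvPolynomial.map (Ideal.Quotient.mk 𝔞) F) :=
      irreducible_of_isAbsIrreducible habs
    exact (Ideal.span_singleton_prime hirr𝔞.ne_zero).mpr hirr𝔞.prime
  obtain ⟨hprime, hmemJ⟩ := isPrime_map_range_of_isPrime_fibre v F hkerR 𝔞 hprimeF
  have hcn : c' ∉ 𝔞.map (algebraMap R B₀) := by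
    intro h
    have hrr : (MvPolynomial.aeval v : MvPolynomial (Fin (m + 1)) R →ₐ[R] E).rangeRestrict rp = c' :=
      Subtype.ext hrp
    exact hγ𝔞 (hγ 𝔞 h𝔞max.isPrime (hmemJ rp (hrr ▸ h)))
  have hgood : ∀ 𝔠 ∈ (Ideal.span {φ c'}).minimalPrimes, 𝔠.comap (algebraMap R Bt) ≠ 𝔞 :=
    hε₃ 𝔞 h𝔞0 hε₃𝔞
  /- Step 7: the fibre of `B'` over `𝔞` is irreducible. -/
  obtain ⟨hPrad, -, -⟩ := isPrime_radical_map_of_goodFibre φ hφ hc' h𝔞0 hprime hcn hgood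
  /- Step 8: primes of `B'` over `𝔞` containing the section curves. -/
  have hsec : ∀ i, ∃ 𝔔 : Ideal Bt, 𝔔.IsPrime ∧
      (RingHom.ker (σ i)).map (algebraMap B Bt) ≤ 𝔔 ∧ ∀ r ∈ 𝔞, ψ r ∈ 𝔔 := by
    intro i
    haveI : (RingHom.ker (σ i)).IsPrime := RingHom.ker_isPrime _
    obtain ⟨𝔯, -, h𝔯p, h𝔯c⟩ := Ideal.exists_ideal_over_prime_of_isIntegral (RingHom.ker (σ i))
      (⊥ : Ideal Bt) (by
        rw [Ideal.comap_bot_of_injective _ (FaithfulSMul.algebraMap_injective B Bt)]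
        exact bot_le)
    haveI := h𝔯p
    have hψι : ∀ p, ψ (algebraMap P R p) = algebraMap B Bt (ι p) := fun p =>
      Subtype.ext (hιR p)
    obtain ⟨𝔔, h𝔔p, h𝔯𝔔, h𝔞𝔔⟩ := exists_prime_over_section (σ i) ι (hσι i) ψ hψι 𝔯 h𝔯c 𝔞
    refine ⟨𝔔, h𝔔p, ?_, h𝔞𝔔⟩
    rw [Ideal.map_le_iff_le_comap, ← h𝔯c]
    exact Ideal.comap_mono h𝔯𝔔
  /- Conclusion. -/
  refine ⟨(𝔞.map (algebraMap R Bt)).radical.comap (algebraMap B Bt), Ideal.comap_isPrime _ _,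
    ?_, fun i => ?_⟩
  · -- nonzero: a nonzero element of `𝔞` gives a nonzero element of `B` in the radical
    obtain ⟨r, hr𝔞, hr0⟩ := Submodule.exists_mem_ne_zero_of_ne_bot h𝔞0
    have hψr : ψ r ∈ (𝔞.map (algebraMap R Bt)).radical :=
      Ideal.le_radical (Ideal.mem_map_of_mem _ hr𝔞)
    have hψr0 : ((ψ r : Bt) : E) ≠ 0 := by
      rw [hψval]
      exact (map_ne_zero_iff _ hRinj).mpr hr0
    obtain ⟨a, b, hb, hab⟩ := IsFractionRing.div_surjective (A := B) ((ψ r : Bt) : E)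
    have hab' : (a : E) / (b : E) = ((ψ r : Bt) : E) := hab
    have hb0 : (b : E) ≠ 0 := by
      intro h
      rw [h, div_zero] at hab'
      exact hψr0 hab'.symm
    have ha : algebraMap B Bt a = algebraMap B Bt b * ψ r := by
      apply Subtype.ext
      change (a : E) = (b : E) * ((ψ r : Bt) : E)
      rw [← hab', ← mul_div_assoc, mul_div_cancel_left₀ _ hb0]
    have ha0 : a ≠ 0 := by
      intro h
      rw [h, ZeroMemClass.coe_zero, zero_div] at hab'
      exact hψr0 hab'.symm
    intro hbot
    have : a ∈ ((𝔞.map (algebraMap R Bt)).radical.comap (algebraMap B Bt)) := by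
      rw [Ideal.mem_comap, ha]
      exact Ideal.mul_mem_left _ _ hψr
    rw [hbot, Ideal.mem_bot] at this
    exact ha0 this
  · obtain ⟨𝔔, h𝔔p, hker𝔔, h𝔞𝔔⟩ := hsec i
    refine ⟨𝔔.comap (algebraMap B Bt), Ideal.comap_isPrime _ _,
      Ideal.map_le_iff_le_comap.mp hker𝔔, Ideal.comap_mono ?_⟩
    exact (h𝔔p.radical_le_iff).mpr (Ideal.map_le_iff_le_comap.mpr fun r hr => h𝔞𝔔 r hr)

set_option maxHeartbeats 800000 in
set_option synthInstance.maxHeartbeats 200000 in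
/-- **Main lemma.** Let `K` be algebraically closed of characteristic `0`, `E` a finitely generated
field over `K` with `trdeg_K E ≥ 2`, `B ⊆ E` a finitely generated `K`-subalgebra with `Frac B = E`
containing an element `t` transcendental over `K`, and `σᵢ : B → K[X]` ring retractions with
`σᵢ(t) = X`, `σᵢ|_K = id`. Then there is a nonzero prime `𝔓 ⊆ B` which, for every `i`, lies
below some prime of `B` containing `ker σᵢ` (apply the core to `P = K[t] ≅ K[X]`, `L` the algebraic
closure of `K(t)` in `E`, `R` the integral closure of `K[t]` in `L`). [cite: MumfordAV1970, §6,
Lemma (proof replaced by an elementary pencil argument)] -/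
theorem exists_prime_le_of_two_sections {K : Type u} [Field K] [IsAlgClosed K] [CharZero K]
    {E : Type u} [Field E] [Algebra K E] [Algebra.EssFiniteType K E]
    (htr : (2 : Cardinal) ≤ Algebra.trdeg K E) (B : Subalgebra K E) [Algebra.FiniteType K B]
    [IsFractionRing B E] {t : E} (htB : t ∈ B) (ht : Transcendental K t) {I : Type*}
    (σ : I → (B →+* K[X])) (hσt : ∀ i, σ i ⟨t, htB⟩ = Polynomial.X)
    (hσK : ∀ i (c : K), σ i (algebraMap K B c) = Polynomial.C c) :
    ∃ 𝔓 : Ideal B, 𝔓.IsPrime ∧ 𝔓 ≠ ⊥ ∧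
      ∀ i, ∃ 𝔔 : Ideal B, 𝔔.IsPrime ∧ RingHom.ker (σ i) ≤ 𝔔 ∧ 𝔓 ≤ 𝔔 := by
  classical
  haveI : CharZero E := charZero_of_injective_algebraMap (algebraMap K E).injective
  /- Step 0: `A₀ = K[t] ≅ K[X]`, a PID inside `B`, with fraction field `F₀ = K(t)`. -/
  let A₀ : Subalgebra K E := Algebra.adjoin K {t}
  have hA₀B : A₀ ≤ B := Algebra.adjoin_le (Set.singleton_subset_iff.mpr htB)
  have hinj : Function.Injective (Polynomial.aeval (R := K) t) := transcendental_iff_injective.mp ht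
  let e : K[X] ≃ₐ[K] A₀ :=
    (AlgEquiv.ofInjective (Polynomial.aeval t) hinj).trans
      (Subalgebra.equivOfEq _ _ (Algebra.adjoin_singleton_eq_range_aeval K t).symm)
  have he : ∀ p : K[X], ((e p : A₀) : E) = Polynomial.aeval t p := fun _ => rfl
  haveI : IsPrincipalIdealRing A₀ :=
    IsPrincipalIdealRing.of_surjective e.toRingEquiv.toRingHom e.surjective
  haveI : IsDedekindDomain A₀ := inferInstance
  have hA₀nf : ¬ IsField A₀ := fun h =>
    Polynomial.not_isField K (MulEquiv.isField h e.toMulEquiv)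
  haveI : FaithfulSMul K A₀ :=
    (faithfulSMul_iff_algebraMap_injective K A₀).mpr (algebraMap K A₀).injective
  /- Step 1: the relative algebraic closure `L = K''` of `F₀ = K(t)` in `E` and the Dedekind
  domain `R`, the integral closure of `A₀` in `L`. -/
  let F₀ : IntermediateField K E := K⟮t⟯
  haveI : CharZero F₀ := charZero_of_injective_algebraMap (algebraMap K F₀).injective
  haveI : PerfectField F₀ := PerfectField.ofCharZero
  haveI : Algebra.EssFiniteType F₀ E := Algebra.EssFiniteType.of_comp K F₀ E
  obtain ⟨K'', hfd, hclos⟩ : ∃ K'' : IntermediateField F₀ E, FiniteDimensional F₀ K'' ∧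
      ∀ z : E, IsAlgebraic K'' z → z ∈ K'' := by
    obtain ⟨s, hsalg, hclos⟩ :=
      Literature.FieldTheory.Regular.exists_finset_isAlgClosedIn (k := F₀) (E := E)
    exact ⟨IntermediateField.adjoin F₀ (s : Set E),
      IntermediateField.finiteDimensional_adjoin fun x hx => (hsalg x hx).isIntegral, hclos⟩
  let L : Type u := K''
  haveI : FiniteDimensional F₀ L := hfd
  haveI : CharZero L := charZero_of_injective_algebraMap (algebraMap K L).injective
  haveI iKLE : IsScalarTower K L E := IsScalarTower.of_algebraMap_eq fun _ => rfl
  haveI iKA₀L : IsScalarTower K A₀ L := IsScalarTower.of_algebraMap_eq fun _ => rfl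
  haveI iA₀LE : IsScalarTower A₀ L E := IsScalarTower.of_algebraMap_eq fun _ => rfl
  have hrac : ∀ z : E, IsAlgebraic L z → z ∈ Set.range (algebraMap L E) := fun z hz =>
    ⟨⟨z, hclos z hz⟩, rfl⟩
  let R : Type u := integralClosure A₀ L
  haveI : IsDedekindDomain R := integralClosure.isDedekindDomain A₀ F₀ L
  haveI : IsFractionRing R L := integralClosure.isFractionRing_of_finite_extension F₀ L
  haveI : Module.Finite A₀ R := IsIntegralClosure.finite A₀ F₀ L R
  haveI iKA₀R : IsScalarTower K A₀ R := IsScalarTower.of_algebraMap_eq fun c => Subtype.ext rfl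
  haveI : FaithfulSMul A₀ R := (faithfulSMul_iff_algebraMap_injective A₀ R).mpr fun a b h =>
    Subtype.ext (congrArg (fun r : R => ((r : L) : E)) h)
  haveI : Algebra.FiniteType K A₀ :=
    (Subalgebra.fg_iff_finiteType A₀).mp ⟨{t}, by simp [A₀]⟩
  haveI : Algebra.FiniteType K R := Algebra.FiniteType.trans (S := A₀) inferInstance inferInstance
  haveI : IsJacobsonRing R := isJacobsonRing_of_finiteType (A := K) (B := R)
  have hRnf : ¬ IsField R := fun h =>
    hA₀nf (isField_of_isIntegral_of_isField (FaithfulSMul.algebraMap_injective A₀ R) h)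
  -- the `R`-algebra structure on `E` (through `L`), with the scalar action `E` already carries
  letI algRE : Algebra R E :=
    { toSMul := inferInstance
      algebraMap := (algebraMap L E).comp (algebraMap R L)
      commutes' := fun r e => mul_comm _ _
      smul_def' := fun r e => rfl }
  have hRval : ∀ r : R, algebraMap R E r = ((r : L) : E) := fun _ => rfl
  haveI iRLE : IsScalarTower R L E := IsScalarTower.of_algebraMap_eq fun _ => rfl
  haveI iKRE : IsScalarTower K R E := IsScalarTower.of_algebraMap_eq fun c => by
    rw [hRval]; rfl
  /- `E` is transcendental over `L`: `trdeg_K E = trdeg_K L + trdeg_L E = 1 + trdeg_L E ≥ 2`. -/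
  have htrans : ¬ Algebra.IsAlgebraic L E := by
    intro halg
    haveI : Algebra.IsAlgebraic F₀ E := Algebra.IsAlgebraic.trans F₀ L E
    haveI : Algebra.IsAlgebraic A₀ E :=
      (IsFractionRing.comap_isAlgebraic_iff (A := A₀) (K := F₀) (C := E)).mpr inferInstance
    have h1 := trdeg_add_eq K A₀ (A := E)
    rw [trdeg_eq_zero (R := A₀) (A := E), add_zero, ← e.trdeg_eq,
      Polynomial.trdeg_of_isDomain] at h1
    rw [← h1] at htr
    norm_num at htr
  /- `R ⊆ B'`. -/
  have hRB' : ∀ r : R, algebraMap R E r ∈ integralClosure B E := by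
    intro r
    have h1 : IsIntegral A₀ (algebraMap R E r) := by
      rw [hRval]
      exact (r.2 : IsIntegral A₀ (r : L)).algebraMap
    letI : Algebra A₀ B := (Subalgebra.inclusion hA₀B).toAlgebra
    haveI : IsScalarTower A₀ B E := IsScalarTower.of_algebraMap_eq fun _ => rfl
    exact (h1.tower_top : IsIntegral B _)
  /- the retractions onto `A₀`. -/
  let ι : A₀ →+* B := (Subalgebra.inclusion hA₀B).toRingHom
  have hιR : ∀ a : A₀, algebraMap R E (algebraMap A₀ R a) = (ι a : E) := fun _ => rfl
  let σ' : I → (B →+* A₀) := fun i => e.toRingEquiv.toRingHom.comp (σ i)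
  have hιe : ∀ i (p : K[X]), σ i (ι (e p)) = p := by
    intro i
    have hχ : (σ i).comp (ι.comp e.toRingEquiv.toRingHom) = RingHom.id K[X] := by
      refine Polynomial.ringHom_ext (fun c => ?_) ?_
      · rw [RingHom.comp_apply, RingHom.comp_apply, RingHom.id_apply, Polynomial.C_eq_algebraMap]
        change σ i (ι (e (algebraMap K K[X] c))) = _
        rw [e.commutes]
        change σ i (Subalgebra.inclusion hA₀B (algebraMap K A₀ c)) = _
        rw [(Subalgebra.inclusion hA₀B).commutes, hσK, Polynomial.C_eq_algebraMap]
      · rw [RingHom.comp_apply, RingHom.comp_apply, RingHom.id_apply]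
        change σ i (ι (e Polynomial.X)) = _
        have : ι (e Polynomial.X) = ⟨t, htB⟩ := Subtype.ext (by
          change ((e Polynomial.X : A₀) : E) = t
          rw [he, Polynomial.aeval_X])
        rw [this, hσt]
    intro p
    have := congrArg (fun f : K[X] →+* K[X] => f p) hχ
    simpa using this
  have hσι : ∀ i a, σ' i (ι a) = a := by
    intro i a
    obtain ⟨p, rfl⟩ := e.surjective a
    change e (σ i (ι (e p))) = e p
    rw [hιe]
  obtain ⟨𝔓, h𝔓p, h𝔓0, h𝔓⟩ :=
    exists_prime_le_of_sections_core (K := K) B hrac htrans hRnf hRB' ι hιR σ' hσι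
  refine ⟨𝔓, h𝔓p, h𝔓0, fun i => ?_⟩
  obtain ⟨𝔔, h𝔔p, hker, hle⟩ := h𝔓 i
  refine ⟨𝔔, h𝔔p, fun b hb => hker ?_, hle⟩
  rw [RingHom.mem_ker] at hb ⊢
  change e (σ i b) = 0
  rw [hb, map_zero]

end MainLemma

/-! ## Two maximal ideals lie over a common prime of coheight one -/

section Alg

set_option maxHeartbeats 800000 in
/-- **Mumford's lemma, affine algebraic form.** For an algebraically closed field `K` of
characteristic zero, a finitely generated `K`-domain `A` and two distinct maximal ideals
`𝔪₁ ≠ 𝔪₂`, there is a prime `𝔭 ⊆ 𝔪₁ ∩ 𝔪₂` with `dim A/𝔭 = 1` (strong induction on `dim A`).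
[cite: MumfordAV1970, §6, Lemma] -/
theorem exists_prime_le_inf_ringKrullDim_quotient_eq_one {K : Type u} [Field K] [IsAlgClosed K]
    [CharZero K] (n : ℕ) :
    ∀ (A : Type u) [CommRing A] [IsDomain A] [Algebra K A] [Algebra.FiniteType K A],
      ringKrullDim A = n → ∀ (m₁ m₂ : Ideal A), m₁.IsMaximal → m₂.IsMaximal → m₁ ≠ m₂ →
        ∃ p : Ideal A, p.IsPrime ∧ p ≤ m₁ ∧ p ≤ m₂ ∧ ringKrullDim (A ⧸ p) = 1 := by
  induction n using Nat.strong_induction_on with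
  | _ n ih =>
  intro A _ _ _ _ hdim m₁ m₂ hm₁ hm₂ hne
  classical
  haveI : IsNoetherianRing A := Algebra.FiniteType.isNoetherianRing K A
  -- heights of maximal ideals
  have hht : ∀ (m : Ideal A), m.IsMaximal → m.height = n := by
    intro m hm
    have := Literature.AlgebraicGeometry.Resolution.height_eq_ringKrullDim_of_isMaximal K m
    rw [hdim] at this
    exact_mod_cast this
  rcases Nat.lt_or_ge n 2 with hn | hn
  · -- `n = 0` is impossible and for `n = 1` the zero ideal works
    have h0 : n ≠ 0 := by
      intro h0
      have h1 : m₁.height = 0 := by rw [hht m₁ hm₁, h0, Nat.cast_zero]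
      have h2 : m₂.height = 0 := by rw [hht m₂ hm₂, h0, Nat.cast_zero]
      rw [Ideal.height_eq_zero_iff_eq_bot] at h1 h2
      exact hne (h1.trans h2.symm)
    have hn1 : n = 1 := by omega
    refine ⟨⊥, Ideal.isPrime_bot, bot_le, bot_le, ?_⟩
    rw [ringKrullDim_eq_of_ringEquiv (RingEquiv.quotientBot A), hdim, hn1, Nat.cast_one]
  -- `n ≥ 2`: the pencil `A[g/h]`
  have h₁ : 2 ≤ m₁.height := by rw [hht m₁ hm₁]; exact_mod_cast hn
  have h₂ : 2 ≤ m₂.height := by rw [hht m₂ hm₂]; exact_mod_cast hn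
  obtain ⟨g, h, hg0, hgm, hhm, hgh⟩ := exists_mem_inf_notMem_minimalPrimes hne h₁ h₂
  have Hgh : ∀ 𝔭 ∈ (Ideal.span {g, h}).minimalPrimes, 2 ≤ 𝔭.height := fun 𝔭 h𝔭 =>
    two_le_height_of_mem_minimalPrimes_span_pair hg0 hgh h𝔭
  have hgu : ¬ IsUnit g := fun hu =>
    hm₁.ne_top (Ideal.eq_top_of_isUnit_mem _ (Ideal.mem_inf.mp hgm).1 hu)
  have hh0 : h ≠ 0 := by
    rintro rfl
    obtain ⟨𝔭, h𝔭⟩ := Ideal.nonempty_minimalPrimes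
      (show Ideal.span {g} ≠ ⊤ by rwa [Ne, Ideal.span_singleton_eq_top])
    exact hgh 𝔭 h𝔭 (zero_mem 𝔭)
  let E := FractionRing A
  let t : E := algebraMap A E g / algebraMap A E h
  have ht : Transcendental K t := transcendental_div_of_notMem_minimalPrimes hg0 hgu hgh
  -- the pencil ring as a `K`-subalgebra of `E`
  let BK : Subalgebra K E := ((pencilHom g h).restrictScalars K).range
  have htB : t ∈ BK := ⟨X, pencilHom_X g h⟩
  have hAB : ∀ a : A, algebraMap A E a ∈ BK := fun a => ⟨C a, pencilHom_C g h a⟩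
  haveI : Algebra.FiniteType K BK :=
    Algebra.FiniteType.of_surjective ((pencilHom g h).restrictScalars K).rangeRestrict
      (AlgHom.rangeRestrict_surjective _)
  haveI : IsFractionRing BK E := isFractionRing_of_subalgebra (A := A) BK hAB
  -- `trdeg_K E = dim A = n ≥ 2`
  have htr : (2 : Cardinal) ≤ Algebra.trdeg K E := by
    obtain ⟨s, hs, hst⟩ := Literature.RingTheory.KrullDimension.exists_ringKrullDim_eq_and_trdeg_eq K A
    rw [hdim] at hs
    have hsn : s = n := by exact_mod_cast hs.symm
    haveI : Algebra.IsAlgebraic A E := IsLocalization.isAlgebraic E (nonZeroDivisors A)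
    haveI : FaithfulSMul K A :=
      (faithfulSMul_iff_algebraMap_injective K A).mpr (algebraMap K A).injective
    have h1 := trdeg_add_eq K A (A := E)
    rw [trdeg_eq_zero (R := A) (A := E), add_zero, hst, hsn] at h1
    rw [← h1]
    exact_mod_cast hn
  -- rational points and sections
  obtain ⟨ev₁, hev₁⟩ := exists_algHom_ker_eq_of_isMaximal (K := K) m₁
  obtain ⟨ev₂, hev₂⟩ := exists_algHom_ker_eq_of_isMaximal (K := K) m₂
  let ev : Bool → (A →ₐ[K] K) := fun b => cond b ev₁ ev₂
  let mm : Bool → Ideal A := fun b => cond b m₁ m₂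
  have hmm : ∀ b, (mm b).IsMaximal := fun b => by cases b <;> assumption
  have hevker : ∀ b, RingHom.ker (ev b) = mm b := fun b => by cases b <;> assumption
  have hevg : ∀ b, (ev b).toRingHom g = 0 := fun b => by
    change ev b g = 0
    rw [← RingHom.mem_ker, hevker]
    cases b
    · exact (Ideal.mem_inf.mp hgm).2
    · exact (Ideal.mem_inf.mp hgm).1
  have hevh : ∀ b, (ev b).toRingHom h = 0 := fun b => by
    change ev b h = 0
    rw [← RingHom.mem_ker, hevker]
    cases b
    · exact (Ideal.mem_inf.mp hhm).2
    · exact (Ideal.mem_inf.mp hhm).1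
  let κ : BK →+* pencilRing g h :=
    { toFun := fun z => ⟨z.1, z.2⟩
      map_one' := rfl
      map_mul' := fun _ _ => rfl
      map_zero' := rfl
      map_add' := fun _ _ => rfl }
  let σ : Bool → (BK →+* K[X]) := fun b =>
    (sectionOfZero hh0 Hgh (ev b).toRingHom (hevg b) (hevh b)).comp κ
  have hσt : ∀ b, σ b ⟨t, htB⟩ = X := by
    intro b
    have h1 : κ ⟨t, htB⟩ = ⟨algebraMap A _ g / algebraMap A _ h, X, pencilHom_X g h⟩ :=
      Subtype.ext rfl
    change sectionOfZero hh0 Hgh (ev b).toRingHom (hevg b) (hevh b) (κ ⟨t, htB⟩) = X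
    rw [h1, sectionOfZero_div]
  have hκA : ∀ a : A, κ ⟨algebraMap A E a, hAB a⟩ = algebraMap A (pencilRing g h) a := fun a =>
    Subtype.ext rfl
  have hσK : ∀ b (c : K), σ b (algebraMap K BK c) = C c := by
    intro b c
    have h1 : algebraMap K BK c = ⟨algebraMap A E (algebraMap K A c), hAB _⟩ :=
      Subtype.ext (IsScalarTower.algebraMap_apply K A E c)
    change sectionOfZero hh0 Hgh (ev b).toRingHom (hevg b) (hevh b) (κ (algebraMap K BK c)) = C c
    rw [h1, hκA, sectionOfZero_algebraMap]
    change C (ev b (algebraMap K A c)) = C c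
    rw [(ev b).commutes, Algebra.algebraMap_self_apply]
  obtain ⟨𝔓, h𝔓p, h𝔓0, h𝔓𝔔⟩ := exists_prime_le_of_two_sections htr BK htB ht σ hσt hσK
  -- pull the prime back to `A`
  let jA : A →+* BK := (algebraMap A E).codRestrict BK hAB
  have hσjA : ∀ b a, σ b (jA a) = C (ev b a) := by
    intro b a
    change sectionOfZero hh0 Hgh (ev b).toRingHom (hevg b) (hevh b) (κ (jA a)) = _
    have : κ (jA a) = algebraMap A (pencilRing g h) a := Subtype.ext rfl
    rw [this, sectionOfZero_algebraMap]
    rfl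
  let 𝔭 : Ideal A := 𝔓.comap jA
  have h𝔭p : 𝔭.IsPrime := Ideal.comap_isPrime _ _
  have h𝔭le : ∀ b, 𝔭 ≤ mm b := by
    intro b
    obtain ⟨𝔔, h𝔔p, hker, hle⟩ := h𝔓𝔔 b
    have hcomap : 𝔔.comap jA = mm b := by
      refine ((hmm b).eq_of_le (Ideal.comap_ne_top _ h𝔔p.ne_top) fun a ha => ?_).symm
      rw [Ideal.mem_comap]
      apply hker
      rw [RingHom.mem_ker, hσjA]
      have : ev b a = 0 := by
        rw [← RingHom.mem_ker, hevker]
        exact ha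
      rw [this, map_zero]
    change 𝔓.comap jA ≤ mm b
    rw [← hcomap]
    exact Ideal.comap_mono hle
  have h𝔭₁ : 𝔭 ≤ m₁ := h𝔭le true
  have h𝔭₂ : 𝔭 ≤ m₂ := h𝔭le false
  have h𝔭0 : 𝔭 ≠ ⊥ := by
    obtain ⟨z, hz𝔓, hz0⟩ := Submodule.exists_mem_ne_zero_of_ne_bot h𝔓0
    have hz0' : (z : E) ≠ 0 := fun h0 => hz0 (Subtype.ext h0)
    obtain ⟨a, b, hb, hab⟩ := IsFractionRing.div_surjective (A := A) (z : E)
    have hb0 : algebraMap A E b ≠ 0 := by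
      intro h0
      rw [h0, div_zero] at hab
      exact hz0' hab.symm
    have ha : jA a = jA b * z := by
      apply Subtype.ext
      change algebraMap A E a = algebraMap A E b * (z : E)
      rw [← hab, ← mul_div_assoc, mul_div_cancel_left₀ _ hb0]
    have ha0 : a ≠ 0 := by
      intro h0
      rw [h0, map_zero, zero_div] at hab
      exact hz0' hab.symm
    intro hbot
    have : a ∈ 𝔭 := by
      change a ∈ 𝔓.comap jA
      rw [Ideal.mem_comap, ha]
      exact Ideal.mul_mem_left _ _ hz𝔓
    rw [hbot, Ideal.mem_bot] at this
    exact ha0 this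
  haveI := h𝔭p
  -- the quotient `A/𝔭` has smaller dimension and two distinct maximal ideals over `𝔪₁, 𝔪₂`
  obtain ⟨n', hn', -⟩ :=
    Literature.RingTheory.KrullDimension.exists_ringKrullDim_eq_and_trdeg_eq K (A ⧸ 𝔭)
  have hlt : n' < n := by
    have h1 := Literature.RingTheory.KrullDimension.ringKrullDim_quotient_add_one_le h𝔭0
    rw [hn', hdim] at h1
    have h2 : ((n' + 1 : ℕ) : WithBot ℕ∞) ≤ n := by exact_mod_cast h1
    have h3 : n' + 1 ≤ n := by exact_mod_cast h2
    omega
  let π := Ideal.Quotient.mk 𝔭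
  have hπs : Function.Surjective π := Ideal.Quotient.mk_surjective
  have hcm : ∀ m : Ideal A, 𝔭 ≤ m → (m.map π).comap π = m := by
    intro m hm
    rw [Ideal.comap_map_of_surjective π hπs, ← RingHom.ker_eq_comap_bot, Ideal.mk_ker,
      sup_eq_left.mpr hm]
  have hM : ∀ m : Ideal A, m.IsMaximal → 𝔭 ≤ m → (m.map π).IsMaximal := by
    intro m hm hpm
    rcases Ideal.map_eq_top_or_isMaximal_of_surjective π hπs hm with h | h
    · exfalso
      apply hm.ne_top
      rw [← hcm m hpm, h, Ideal.comap_top]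
    · exact h
  have hMne : m₁.map π ≠ m₂.map π := fun heq => hne (by rw [← hcm m₁ h𝔭₁, ← hcm m₂ h𝔭₂, heq])
  obtain ⟨𝔮', h𝔮'p, h𝔮'₁, h𝔮'₂, hdim'⟩ :=
    ih n' hlt (A ⧸ 𝔭) hn' (m₁.map π) (m₂.map π) (hM m₁ hm₁ h𝔭₁) (hM m₂ hm₂ h𝔭₂) hMne
  haveI := h𝔮'p
  have h𝔭𝔮 : 𝔭 ≤ 𝔮'.comap π := by
    intro a ha
    rw [Ideal.mem_comap, Ideal.Quotient.eq_zero_iff_mem.mpr ha]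
    exact zero_mem _
  have hmap : (𝔮'.comap π).map π = 𝔮' := Ideal.map_comap_of_surjective π hπs 𝔮'
  refine ⟨𝔮'.comap π, Ideal.comap_isPrime _ _, ?_, ?_, ?_⟩
  · exact (Ideal.comap_mono h𝔮'₁).trans (hcm m₁ h𝔭₁).le
  · exact (Ideal.comap_mono h𝔮'₂).trans (hcm m₂ h𝔭₂).le
  · rw [← ringKrullDim_eq_of_ringEquiv (DoubleQuot.quotQuotEquivQuotOfLE h𝔭𝔮),
      ringKrullDim_eq_of_ringEquiv (Ideal.quotEquivOfEq hmap), hdim']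

end Alg

end TwoPointPencil

end Literature.AlgebraicGeometry.Motives

end
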